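import Summits.RiemannHypothesis.RiemannHypothesis.Theorems.SignConeConeMagnificationTorusFiniteMean
import Literature.NumberTheory.DiophantineApproximation.KroneckerPrimes

/-!
# `SignCone.ConeMagnification`, line `Sketch`: the Carathéodory–Kronecker `ℓ¹` bound at the primes
(crux stmt-RiemannHypothesis-16303; HELPER file, `--supports`)

A Bohr–Carathéodory inequality for Dirichlet polynomials: if `a : ℕ → ℝ` has `a 1 = 0` and
`Σ_{1 ≤ n < N} a(n) n^{-1/2} cos(t log n) ≤ 1/2` for every real `t`, then

  `Σ_{p < N prime} |a(p)| p^{-1/2} ≤ 1`   (`sum_prime_abs_div_sqrt_le_one`).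

Proof (the finite-support endgame of the crux idea card `polydisc-caratheodory-deficit`, made rigorous):
* KRONECKER TRANSFER (`cosPhase_sum_le_half`): by Kronecker's theorem for the prime phases
  (`Kronecker.exists_abs_ge_forall_prime_norm_cpow_sub_lt`) and `n^{it} = Π_{q | n} q^{it}` over the prime factors
  with multiplicity, the hypothesis transfers from the flow `(p^{it})_p` to EVERY point of the torus:
  `Σ_n a(n) n^{-1/2} cos(Σ_{q ∈ primeFactorsList n} Φ_q) ≤ 1/2` for all phase assignments `Φ`;
* FEJÉR ON THE JOINT ROTATION (`sum_prime_abs_div_sqrt_le_one`): along `Φ + θ` the phase of `n` moves by `Ω(n) θ`;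
  multiplying `1/2 − Re G(θ) ≥ 0` by the Fejér kernel `1 + cos θ ≥ 0` and extracting the zero frequency
  (`re_sum_filter_nonneg_of_trigSum_re_nonneg`, file `…TorusFiniteMean.lean`) leaves the terms with `Ω(n) = 1`, i.e. the
  PRIMES: `Re Σ_p a(p) p^{-1/2} e^{iΦ_p} ≤ 1 − 2a(1) = 1`; the signs `Φ_p ∈ {0, π}` give the `ℓ¹` bound.
Consequence for the crux (`…PrimeDiscrepancy.lean`): a Carathéodory-admissible weight `c` with `c − Λ` finitely supported has
TWO-SIDED prime discrepancy `Σ_p |c(p) − log p|/√p ≤ 1` (deficit AND surplus), sharper than the torus/Fejér route's deficit bound `2`.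
-/

noncomputable section

-- `Summit.RiemannHypothesis.RiemannHypothesis.…` repeats a namespace component by design (D-0017 layout).
set_option linter.dupNamespace false

open scoped BigOperators
open Complex Finset

namespace Summit.RiemannHypothesis.RiemannHypothesis.Theorems.SignConeConeMagnification

open Literature.NumberTheory.DiophantineApproximation

/-! ## Products over prime factors with multiplicity -/

/-- A list of positive naturals has positive product. [folklore] -/
theorem list_prod_pos_of_forall_pos (L : List ℕ) (hL : ∀ q ∈ L, 0 < q) : 0 < L.prod := by
  induction L with
  | nil => simp
  | cons q L ih =>
    rw [List.prod_cons]
    exact Nat.mul_pos (hL q (by simp)) (ih fun r hr => hL r (by simp [hr]))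

/-- `e^{it log(Π L)} = Π_{q ∈ L} e^{it log q}` for a list of positive naturals. [folklore] -/
theorem cexp_mul_log_list_prod (L : List ℕ) (hL : ∀ q ∈ L, 0 < q) (t : ℝ) :
    cexp (((t * Real.log ((L.prod : ℕ) : ℝ) : ℝ) : ℂ) * I) =
      (L.map fun q : ℕ => cexp (((t * Real.log (q : ℝ) : ℝ) : ℂ) * I)).prod := by
  induction L with
  | nil => simp
  | cons q L ih =>
    have hq : 0 < q := hL q (by simp)
    have hL' : ∀ r ∈ L, 0 < r := fun r hr => hL r (by simp [hr])
    have hP : 0 < L.prod := list_prod_pos_of_forall_pos L hL'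
    rw [List.prod_cons, List.map_cons, List.prod_cons, ← ih hL', ← Complex.exp_add, Nat.cast_mul,
      Real.log_mul (by exact_mod_cast hq.ne') (by exact_mod_cast hP.ne')]
    congr 1
    push_cast
    ring

/-- `e^{i Σ_{q∈L} Φ_q} = Π_{q∈L} e^{iΦ_q}`. [folklore] -/
theorem cexp_list_sum_phase (L : List ℕ) (Φ : ℕ → ℝ) :
    cexp ((((L.map Φ).sum : ℝ) : ℂ) * I) = (L.map fun q : ℕ => cexp (((Φ q : ℝ) : ℂ) * I)).prod := by
  induction L with
  | nil => simp
  | cons q L ih =>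
    rw [List.map_cons, List.sum_cons, List.map_cons, List.prod_cons, ← ih, ← Complex.exp_add]
    congr 1
    push_cast
    ring

/-- A product of factors of norm `≤ 1` has norm `≤ 1`. [folklore] -/
theorem norm_list_prod_le_one (L : List ℕ) (x : ℕ → ℂ) (hx : ∀ q ∈ L, ‖x q‖ ≤ 1) : ‖(L.map x).prod‖ ≤ 1 := by
  induction L with
  | nil => simp
  | cons q L ih =>
    rw [List.map_cons, List.prod_cons, norm_mul]
    have h1 := hx q (by simp)
    have h2 := ih (fun r hr => hx r (by simp [hr]))
    calc ‖x q‖ * ‖(L.map x).prod‖ ≤ 1 * 1 := mul_le_mul h1 h2 (norm_nonneg _) zero_le_one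
      _ = 1 := one_mul _

/-- **Telescoping**: `‖Π x_q − Π y_q‖ ≤ Σ ‖x_q − y_q‖` for factors of norm `≤ 1`. [folklore] -/
theorem norm_list_prod_sub_prod_le (L : List ℕ) (x y : ℕ → ℂ) (hx : ∀ q ∈ L, ‖x q‖ ≤ 1) (hy : ∀ q ∈ L, ‖y q‖ ≤ 1) :
    ‖(L.map x).prod - (L.map y).prod‖ ≤ (L.map fun q => ‖x q - y q‖).sum := by
  induction L with
  | nil => simp
  | cons q L ih =>
    rw [List.map_cons, List.prod_cons, List.map_cons, List.prod_cons, List.map_cons, List.sum_cons]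
    have hxq := hx q (by simp)
    have hyL := norm_list_prod_le_one L y (fun r hr => hy r (by simp [hr]))
    have ih' := ih (fun r hr => hx r (by simp [hr])) (fun r hr => hy r (by simp [hr]))
    have e : x q * (L.map x).prod - y q * (L.map y).prod =
        x q * ((L.map x).prod - (L.map y).prod) + (x q - y q) * (L.map y).prod := by ring
    rw [e]
    calc ‖x q * ((L.map x).prod - (L.map y).prod) + (x q - y q) * (L.map y).prod‖
        ≤ ‖x q‖ * ‖(L.map x).prod - (L.map y).prod‖ + ‖x q - y q‖ * ‖(L.map y).prod‖ := by
          refine (norm_add_le _ _).trans ?_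
          rw [norm_mul, norm_mul]
      _ ≤ 1 * ‖(L.map x).prod - (L.map y).prod‖ + ‖x q - y q‖ * 1 := by
          gcongr
      _ ≤ ‖x q - y q‖ + (L.map fun q => ‖x q - y q‖).sum := by linarith

/-! ## Kronecker transfer: from the flow to the whole torus -/

/-- **Kronecker transfer.**  If `Σ_{1≤n<N} a(n) n^{-1/2} cos(t log n) ≤ 1/2` for all real `t`, then for EVERY phase
assignment `Φ`, `Σ_{1≤n<N} a(n) n^{-1/2} cos(Σ_{q ∈ primeFactorsList n} Φ_q) ≤ 1/2`
(Kronecker's theorem for the prime phases `p^{it}`, `p < N`; `n^{it} = Π_q q^{it}` and `|Π x_q − Π y_q| ≤ Σ|x_q − y_q|`). [folklore] -/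
theorem cosPhase_sum_le_half (a : ℕ → ℝ) (N : ℕ)
    (h : ∀ t : ℝ, ∑ n ∈ Finset.Ico 1 N, a n / Real.sqrt n * Real.cos (Real.log n * t) ≤ 1 / 2) (Φ : ℕ → ℝ) :
    ∑ n ∈ Finset.Ico 1 N, a n / Real.sqrt n * Real.cos ((n.primeFactorsList.map Φ).sum) ≤ 1 / 2 := by
  set C : ℝ := ∑ n ∈ Finset.Ico 1 N, |a n| / Real.sqrt n * (n.primeFactorsList.length : ℝ) with hC
  have hC0 : 0 ≤ C := Finset.sum_nonneg fun n _ => by positivity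
  refine le_of_forall_pos_lt_add fun δ hδ => ?_
  set ε : ℝ := δ / (C + 1) with hε_def
  have hε : 0 < ε := by positivity
  have hCε : C * ε < δ := by
    rw [hε_def, mul_div_assoc']
    rw [div_lt_iff₀ (by positivity)]
    nlinarith
  -- Kronecker for the prime phases below `N`
  obtain ⟨t, -, ht⟩ := Kronecker.exists_abs_ge_forall_prime_norm_cpow_sub_lt N
    (fun q => cexp (((Φ q : ℝ) : ℂ) * I)) (fun q _ => by exact norm_exp_ofReal_mul_I _) hε 0
  -- termwise comparison
  have key : ∀ n ∈ Finset.Ico 1 N,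
      |Real.cos (Real.log n * t) - Real.cos ((n.primeFactorsList.map Φ).sum)| ≤ n.primeFactorsList.length * ε := by
    intro n hn
    have hn1 : 1 ≤ n := (Finset.mem_Ico.mp hn).1
    have hn0 : n ≠ 0 := by omega
    have hnN : n < N := (Finset.mem_Ico.mp hn).2
    set L := n.primeFactorsList with hL
    have hLpos : ∀ q ∈ L, 0 < q := fun q hq => Nat.pos_of_mem_primeFactorsList hq
    -- the two unimodular products
    have e1 : cexp (((t * Real.log (n : ℝ) : ℝ) : ℂ) * I) =
        (L.map fun q : ℕ => cexp (((t * Real.log (q : ℝ) : ℝ) : ℂ) * I)).prod := by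
      have := cexp_mul_log_list_prod L hLpos t
      rw [hL, Nat.prod_primeFactorsList hn0] at this
      rw [hL]
      exact this
    have e2 := cexp_list_sum_phase L Φ
    have hdiff := norm_list_prod_sub_prod_le L (fun q : ℕ => cexp (((t * Real.log (q : ℝ) : ℝ) : ℂ) * I))
      (fun q : ℕ => cexp (((Φ q : ℝ) : ℂ) * I)) (fun q _ => (norm_exp_ofReal_mul_I _).le)
      (fun q _ => (norm_exp_ofReal_mul_I _).le)
    -- each factor is `ε`-close (Kronecker), `q^{it} = e^{it log q}`
    have hterm : ∀ q : ℕ, q ∈ L → ‖cexp (((t * Real.log (q : ℝ) : ℝ) : ℂ) * I) - cexp (((Φ q : ℝ) : ℂ) * I)‖ ≤ ε := by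
      intro q hq
      have hqp : q.Prime := Nat.prime_of_mem_primeFactorsList hq
      have hqN : q ≤ N := ((Nat.le_of_mem_primeFactorsList hq).trans hnN.le)
      have := ht q hqp hqN
      rw [Kronecker.natCast_cpow_mul_I hqp.ne_zero] at this
      exact this.le
    have hsum : (L.map fun q : ℕ => ‖cexp (((t * Real.log (q : ℝ) : ℝ) : ℂ) * I) - cexp (((Φ q : ℝ) : ℂ) * I)‖).sum ≤
        L.length * ε := by
      calc (L.map fun q : ℕ => ‖cexp (((t * Real.log (q : ℝ) : ℝ) : ℂ) * I) - cexp (((Φ q : ℝ) : ℂ) * I)‖).sum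
          ≤ (L.map fun _ => ε).sum := List.sum_le_sum (fun q hq => hterm q hq)
        _ = L.length * ε := by rw [List.map_const', List.sum_replicate, nsmul_eq_mul]
    -- real parts
    have hre1 : Real.cos (Real.log n * t) = (cexp (((t * Real.log (n : ℝ) : ℝ) : ℂ) * I)).re := by
      rw [exp_ofReal_mul_I_re, mul_comm]
    have hre2 : Real.cos ((n.primeFactorsList.map Φ).sum) = (cexp ((((L.map Φ).sum : ℝ) : ℂ) * I)).re := by
      rw [exp_ofReal_mul_I_re]
    rw [hre1, hre2, ← Complex.sub_re, e1, e2]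
    exact (abs_re_le_norm _).trans (hdiff.trans hsum)
  -- sum up
  have hbound : ∑ n ∈ Finset.Ico 1 N, a n / Real.sqrt n * Real.cos ((n.primeFactorsList.map Φ).sum) ≤
      ∑ n ∈ Finset.Ico 1 N, a n / Real.sqrt n * Real.cos (Real.log n * t) + C * ε := by
    rw [hC, Finset.sum_mul, ← Finset.sum_add_distrib]
    refine Finset.sum_le_sum fun n hn => ?_
    have hk := key n hn
    have h1 : a n / Real.sqrt n * Real.cos ((n.primeFactorsList.map Φ).sum) -
        a n / Real.sqrt n * Real.cos (Real.log n * t) ≤ |a n| / Real.sqrt n * (n.primeFactorsList.length * ε) := by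
      rw [← mul_sub]
      calc a n / Real.sqrt n * (Real.cos ((n.primeFactorsList.map Φ).sum) - Real.cos (Real.log n * t))
          ≤ |a n / Real.sqrt n * (Real.cos ((n.primeFactorsList.map Φ).sum) - Real.cos (Real.log n * t))| :=
            le_abs_self _
        _ = |a n| / Real.sqrt n * |Real.cos (Real.log n * t) - Real.cos ((n.primeFactorsList.map Φ).sum)| := by
            rw [abs_mul, abs_div, abs_of_nonneg (Real.sqrt_nonneg _), abs_sub_comm]
        _ ≤ |a n| / Real.sqrt n * (n.primeFactorsList.length * ε) :=
            mul_le_mul_of_nonneg_left hk (by positivity)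
    have e : |a n| / Real.sqrt n * (n.primeFactorsList.length : ℝ) * ε =
        |a n| / Real.sqrt n * (n.primeFactorsList.length * ε) := by ring
    linarith
  calc ∑ n ∈ Finset.Ico 1 N, a n / Real.sqrt n * Real.cos ((n.primeFactorsList.map Φ).sum)
      ≤ ∑ n ∈ Finset.Ico 1 N, a n / Real.sqrt n * Real.cos (Real.log n * t) + C * ε := hbound
    _ < 1 / 2 + δ := by linarith [h t]

/-! ## Fejér on the joint rotation: the `ℓ¹` bound at the primes -/

/-- Shifting every phase by `θ` moves the phase of `n` by `Ω(n) θ`. [folklore] -/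
theorem list_sum_map_add_const (L : List ℕ) (Φ : ℕ → ℝ) (θ : ℝ) :
    (L.map fun q => Φ q + θ).sum = (L.map Φ).sum + L.length * θ := by
  induction L with
  | nil => simp
  | cons q L ih =>
    simp only [List.map_cons, List.sum_cons, List.length_cons, Nat.cast_add, Nat.cast_one, ih]
    ring

/-- `∫₀^{2π} cos(ψ + kθ) dθ = [k = 0] · 2π cos ψ` for an integer frequency `k`. [folklore] -/
theorem integral_cos_add_int_mul (ψ : ℝ) (k : ℤ) :
    ∫ θ in (0 : ℝ)..2 * Real.pi, Real.cos (ψ + k * θ) = if k = 0 then 2 * Real.pi * Real.cos ψ else 0 := by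
  split_ifs with hk
  · subst hk
    simp
  · have hk' : (k : ℝ) ≠ 0 := by exact_mod_cast hk
    have e : (fun θ : ℝ => Real.cos (ψ + k * θ)) = fun θ => Real.cos (k * θ + ψ) := by
      funext θ; rw [add_comm]
    rw [e, intervalIntegral.integral_comp_mul_add (fun x => Real.cos x) hk' ψ, integral_cos]
    simp only [mul_zero, zero_add, smul_eq_mul]
    have : Real.sin ((k : ℝ) * (2 * Real.pi) + ψ) = Real.sin ψ := by
      rw [add_comm]; exact Real.sin_add_int_mul_two_pi ψ k
    rw [this, sub_self, mul_zero]

/-- The Fejér-kernel integrals: `∫₀^{2π} (1 + cos θ) cos(ψ + Ωθ) dθ = [Ω = 0] 2π cos ψ + [Ω = 1] π cos ψ` (`Ω ∈ ℕ`). [folklore] -/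
theorem integral_fejer_cos (ψ : ℝ) (Ω : ℕ) :
    ∫ θ in (0 : ℝ)..2 * Real.pi, (1 + Real.cos θ) * Real.cos (ψ + Ω * θ) =
      (if Ω = 0 then 2 * Real.pi * Real.cos ψ else 0) + (if Ω = 1 then Real.pi * Real.cos ψ else 0) := by
  -- product-to-sum
  have e : ∀ θ : ℝ, (1 + Real.cos θ) * Real.cos (ψ + Ω * θ) =
      Real.cos (ψ + ((Ω : ℤ) : ℝ) * θ) + (1 / 2) * Real.cos (ψ + ((Ω + 1 : ℤ) : ℝ) * θ) +
        (1 / 2) * Real.cos (ψ + ((Ω - 1 : ℤ) : ℝ) * θ) := by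
    intro θ
    have hc1 : (((Ω : ℤ) : ℝ)) = (Ω : ℝ) := by push_cast; ring
    have hc2 : (((Ω + 1 : ℤ)) : ℝ) = (Ω : ℝ) + 1 := by push_cast; ring
    have hc3 : (((Ω - 1 : ℤ)) : ℝ) = (Ω : ℝ) - 1 := by push_cast; ring
    rw [hc1, hc2, hc3]
    have hA : ψ + ((Ω : ℝ) + 1) * θ = (ψ + Ω * θ) + θ := by ring
    have hB : ψ + ((Ω : ℝ) - 1) * θ = (ψ + Ω * θ) - θ := by ring
    rw [hA, hB, Real.cos_add (ψ + Ω * θ) θ, Real.cos_sub (ψ + Ω * θ) θ]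
    ring
  have hi : ∀ k : ℤ, IntervalIntegrable (fun θ : ℝ => Real.cos (ψ + (k : ℝ) * θ)) MeasureTheory.volume 0 (2 * Real.pi) :=
    fun k => (by fun_prop : Continuous fun θ : ℝ => Real.cos (ψ + (k : ℝ) * θ)).intervalIntegrable _ _
  simp_rw [e]
  rw [intervalIntegral.integral_add ((hi _).add ((hi _).const_mul _)) ((hi _).const_mul _),
    intervalIntegral.integral_add (hi _) ((hi _).const_mul _), intervalIntegral.integral_const_mul,
    intervalIntegral.integral_const_mul, integral_cos_add_int_mul, integral_cos_add_int_mul, integral_cos_add_int_mul,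
    if_neg (by omega : ¬ ((Ω : ℤ) + 1 = 0))]
  by_cases h0 : Ω = 0
  · subst h0
    rw [if_pos (by simp), if_neg (by omega), if_pos rfl, if_neg (by omega)]
    ring
  · by_cases h1 : Ω = 1
    · subst h1
      rw [if_neg (by omega), if_pos (by omega), if_neg (by omega), if_pos rfl]
      ring
    · rw [if_neg (by omega), if_neg (by omega), if_neg h0, if_neg h1]
      ring

/-- **The Carathéodory–Kronecker `ℓ¹` bound.**  If `a 1 = 0` and `Σ_{1≤n<N} a(n) n^{-1/2} cos(t log n) ≤ 1/2` for all
real `t`, then `Σ_{p<N prime} |a(p)| p^{-1/2} ≤ 1`: transfer to all phases (`cosPhase_sum_le_half`), rotate jointly by `θ`,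
integrate `(1 + cos θ)(1/2 − Re G(θ)) ≥ 0` over a period — only `Ω(n) = 1` (primes, coefficient `π cos Φ_p`) and `Ω(n) = 0`
(`n = 1`, coefficient `0` since `a 1 = 0`) survive (`integral_fejer_cos`) — and choose the signs `Φ_p ∈ {0, π}`. [folklore] -/
theorem sum_prime_abs_div_sqrt_le_one (a : ℕ → ℝ) (N : ℕ) (ha1 : a 1 = 0)
    (h : ∀ t : ℝ, ∑ n ∈ Finset.Ico 1 N, a n / Real.sqrt n * Real.cos (Real.log n * t) ≤ 1 / 2) :
    ∑ p ∈ (Finset.Ico 1 N).filter Nat.Prime, |a p| / Real.sqrt p ≤ 1 := by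
  -- signs
  set Φ : ℕ → ℝ := fun q => if 0 ≤ a q then 0 else Real.pi with hΦ
  have hsign : ∀ q, a q * Real.cos (Φ q) = |a q| := by
    intro q
    simp only [hΦ]
    split_ifs with hq
    · rw [Real.cos_zero, mul_one, abs_of_nonneg hq]
    · rw [Real.cos_pi, mul_neg_one, abs_of_neg (not_le.mp hq)]
  -- phases and their joint rotation
  set ψ : ℕ → ℝ := fun n => (n.primeFactorsList.map Φ).sum with hψ
  have hrot : ∀ θ : ℝ, ∑ n ∈ Finset.Ico 1 N, a n / Real.sqrt n * Real.cos (ψ n + n.primeFactorsList.length * θ) ≤ 1 / 2 := by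
    intro θ
    have := cosPhase_sum_le_half a N h (fun q => Φ q + θ)
    refine le_of_eq_of_le (Finset.sum_congr rfl fun n _ => ?_) this
    rw [list_sum_map_add_const]
  -- the Fejér integral is nonnegative
  set Sθ : ℝ → ℝ := fun θ => ∑ n ∈ Finset.Ico 1 N, a n / Real.sqrt n * Real.cos (ψ n + n.primeFactorsList.length * θ)
    with hSθ
  have hcont : Continuous Sθ := by
    simp only [hSθ]
    fun_prop
  have hInonneg : 0 ≤ ∫ θ in (0 : ℝ)..2 * Real.pi, (1 + Real.cos θ) * (1 / 2 - Sθ θ) := by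
    refine intervalIntegral.integral_nonneg (by positivity) fun θ _ => ?_
    have h1 : 0 ≤ 1 + Real.cos θ := by linarith [Real.neg_one_le_cos θ]
    have h2 : 0 ≤ 1 / 2 - Sθ θ := by linarith [hrot θ]
    exact mul_nonneg h1 h2
  -- evaluate the integral
  have hterm : ∀ n ∈ Finset.Ico 1 N,
      ∫ θ in (0 : ℝ)..2 * Real.pi, (1 + Real.cos θ) * (a n / Real.sqrt n * Real.cos (ψ n + n.primeFactorsList.length * θ)) =
        if n.Prime then Real.pi * (|a n| / Real.sqrt n) else 0 := by
    intro n hn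
    have hn1 : 1 ≤ n := (Finset.mem_Ico.mp hn).1
    have e : ∀ θ : ℝ, (1 + Real.cos θ) * (a n / Real.sqrt n * Real.cos (ψ n + n.primeFactorsList.length * θ)) =
        a n / Real.sqrt n * ((1 + Real.cos θ) * Real.cos (ψ n + n.primeFactorsList.length * θ)) := fun θ => by ring
    simp_rw [e]
    rw [intervalIntegral.integral_const_mul, integral_fejer_cos]
    by_cases hp : n.Prime
    · have hL : n.primeFactorsList = [n] := Nat.primeFactorsList_prime hp
      have hψn : ψ n = Φ n := by simp only [hψ, hL, List.map_cons, List.map_nil, List.sum_cons, List.sum_nil, add_zero]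
      rw [if_pos hp, hL]
      simp only [List.length_singleton, one_ne_zero, ↓reduceIte, zero_add]
      rw [hψn]
      have := hsign n
      field_simp
      linarith [this]
    · rw [if_neg hp]
      have hlen1 : n.primeFactorsList.length ≠ 1 := by
        intro h1
        exact hp (ArithmeticFunction.cardFactors_eq_one_iff_prime.mp (by rw [ArithmeticFunction.cardFactors_apply, h1]))
      by_cases hlen0 : n.primeFactorsList.length = 0
      · -- then `n = 1` and `a 1 = 0`
        have hn_eq : n = 1 := by
          have hnil : n.primeFactorsList = [] := List.eq_nil_of_length_eq_zero hlen0
          have := Nat.prod_primeFactorsList (by omega : n ≠ 0)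
          rw [hnil, List.prod_nil] at this
          exact this.symm
        subst hn_eq
        simp [ha1]
      · simp [hlen0, hlen1]
  have hI : ∫ θ in (0 : ℝ)..2 * Real.pi, (1 + Real.cos θ) * (1 / 2 - Sθ θ) =
      Real.pi - Real.pi * ∑ p ∈ (Finset.Ico 1 N).filter Nat.Prime, |a p| / Real.sqrt p := by
    have e : ∀ θ : ℝ, (1 + Real.cos θ) * (1 / 2 - Sθ θ) =
        (1 / 2 + (1 / 2) * Real.cos θ) - ∑ n ∈ Finset.Ico 1 N,
          (1 + Real.cos θ) * (a n / Real.sqrt n * Real.cos (ψ n + n.primeFactorsList.length * θ)) := by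
      intro θ
      simp only [hSθ]
      rw [← Finset.mul_sum]
      ring
    simp_rw [e]
    have hi1 : IntervalIntegrable (fun θ : ℝ => 1 / 2 + 1 / 2 * Real.cos θ) MeasureTheory.volume 0 (2 * Real.pi) :=
      (by fun_prop : Continuous fun θ : ℝ => 1 / 2 + 1 / 2 * Real.cos θ).intervalIntegrable _ _
    have hi2 : ∀ n ∈ Finset.Ico 1 N, IntervalIntegrable
        (fun θ : ℝ => (1 + Real.cos θ) * (a n / Real.sqrt n * Real.cos (ψ n + n.primeFactorsList.length * θ)))
        MeasureTheory.volume 0 (2 * Real.pi) := fun n _ =>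
      (by fun_prop : Continuous fun θ : ℝ =>
        (1 + Real.cos θ) * (a n / Real.sqrt n * Real.cos (ψ n + n.primeFactorsList.length * θ))).intervalIntegrable _ _
    have hi3 : IntervalIntegrable (fun θ : ℝ => ∑ n ∈ Finset.Ico 1 N,
        (1 + Real.cos θ) * (a n / Real.sqrt n * Real.cos (ψ n + n.primeFactorsList.length * θ)))
        MeasureTheory.volume 0 (2 * Real.pi) :=
      (by fun_prop : Continuous fun θ : ℝ => ∑ n ∈ Finset.Ico 1 N,
        (1 + Real.cos θ) * (a n / Real.sqrt n * Real.cos (ψ n + n.primeFactorsList.length * θ))).intervalIntegrable _ _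
    rw [intervalIntegral.integral_sub hi1 hi3,
      intervalIntegral.integral_finsetSum hi2, Finset.sum_congr rfl hterm, Finset.sum_ite, Finset.sum_const_zero,
      add_zero, ← Finset.mul_sum]
    have h0 : ∫ θ in (0 : ℝ)..2 * Real.pi, (1 / 2 + 1 / 2 * Real.cos θ) = Real.pi := by
      have hci : IntervalIntegrable (fun θ : ℝ => 1 / 2 * Real.cos θ) MeasureTheory.volume 0 (2 * Real.pi) :=
        (by fun_prop : Continuous fun θ : ℝ => 1 / 2 * Real.cos θ).intervalIntegrable _ _
      rw [intervalIntegral.integral_add intervalIntegrable_const hci, intervalIntegral.integral_const,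
        intervalIntegral.integral_const_mul, integral_cos]
      simp
      ring
    rw [h0]
  rw [hI] at hInonneg
  have hπ := Real.pi_pos
  by_contra hlt
  push Not at hlt
  nlinarith

/-- **Registered sub-goal form** (closed statement) of `sum_prime_abs_div_sqrt_le_one`: the Carathéodory–Kronecker `ℓ¹`
bound at the primes for Dirichlet polynomials with `Re ≤ 1/2` on the critical line. [folklore] -/
theorem primeCaratheodoryBound :
    ∀ (a : ℕ → ℝ) (N : ℕ), a 1 = 0 →
      (∀ t : ℝ, ∑ n ∈ Finset.Ico 1 N, a n / Real.sqrt n * Real.cos (Real.log n * t) ≤ 1 / 2) →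
      ∑ p ∈ (Finset.Ico 1 N).filter Nat.Prime, |a p| / Real.sqrt p ≤ 1 :=
  fun a N ha1 h => sum_prime_abs_div_sqrt_le_one a N ha1 h

end Summit.RiemannHypothesis.RiemannHypothesis.Theorems.SignConeConeMagnification

end
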